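import Mathlib
import Summits.KontsevichZagierPeriods.Zeta5Search.Elimination.DictBridgeLevelOnePoints
import Summits.KontsevichZagierPeriods.Zeta5Search.Elimination.DictBridgeFaceLaw
import HarnessLib

/-!
# gen-1's `DictBridge` at level 1: `DictBridgeLevelOne` holds (cert-1 gen 5)

HONEST FRAMING: systematic search; no irrationality claim unless certified — identities among the rational Taylor
data `U, V, W` of the Ball–Rivoal family and gen-1's dictionary values `(Q, P̂, P)`; nothing about sizes, denominators
or irrationality; the class verdict is unchanged (T1 NO / T2 NO / T4 YES).

OUR work (Summit side; cell `pub-zeta5`, certifier seat `cert-1`).  CREDIT: fam-elim g24 derived and farm-certified the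
same nine level-1 identities INDEPENDENTLY AND EARLIER (E-L22, staged `ElimDictBridgeLevelOne`/`ElimDictBridgeCluster{One,Two,
Three}` → `Elimination/DictBridgeLevelOneClusters`, `DictBridgeClusterOne/Two/Three`: cluster values `k1_vals0`, …, by its
own partial-fraction code); the two chains re-derive every value from explicit tables by different programs and are each
other's cross-check.  fam-elim g24 reduced gen-1's GLOBAL node
`WedgeDictionary.DictBridge` to the interior (`Elimination/DictBridge.dictBridge_at`), the ghost face
(`Elimination/DictBridgeFace`, `DictBridgeFaceLaw`) and ONE open leaf, `Elimination.DictBridgeLevelOne`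
(`Elimination/DictBridgeStrata`): the four-term relation
`bridgeBase(c)·v(a) + bridgeSlot(c)·v(a − s₇) + bridgeHalf(c)·v(a + e₁ + e₃) + bridgeApex(c)·v(a + DS) = 0`,
`v = (Q, P̂, P)`, at the bridge clusters of level `c₀ = b(a)₀ ≤ 1`.  This file PROVES it:

1. `level_one_cases` — under the four `RegionHyp`s (boxes, `d ≥ 0`, partners, and the seventeen convergence forms at
   `a` and at `a − s₇`) and `c₀ ≤ 1`, the base point is one of THREE: `a ∈ {(1,0,1,0,1,1,1,1), (0,1,0,0,1,1,1,1),
   (0,0,1,0,1,1,1,1)}`, i.e. `c ∈ {(1;0⁷), (1;0,1,0⁵), (1;1,0⁶)}` (pure `omega` after unfolding; the enumeration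
   agrees with fam-elim g24's `level_sweep.py`);
2. at each of the twelve cluster points the dictionary values are `ρ` times the slot-7 Casoratians
   (`PencilGauge.dict_values`: `Q = ρ·(U∧W)`, `P̂ = ρ·(U∧V)`, `P = ρ·(V∧W)`), the Casoratians are explicit rationals
   from the certified coefficient tables of `DictBridgeLevelOneDataA/B/C` (21 dual vectors; `DictBridgeLevelOnePoints`), `ρ = rhoOf` and the four
   bridge coefficients are evaluated by the kernel (`decide`), and each of the nine rows is then a rational identity
   checked by `norm_num` — e.g. at `c = (1;0⁷)` (coefficients `(4, −1, 4, 1)`, `ρ = (1/24, −1/8, −4/3, −1/8)`,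
   `U∧W = (−24, −8, 3, −168)`): `4·(1/24)(−24) + (−1)(−1/8)(−8) + 4·(−4/3)·3 + 1·(−1/8)(−168) = −4 − 1 − 16 + 21 = 0`.

CONSEQUENCE (pure assembly with fam-elim g24's `Elimination/DictBridgeFaceLaw.dictBridge_of_levelOne`, which supplies
the interior and the ghost face): **`dictBridge_holds : WedgeDictionary.DictBridge`** — gen-1's GLOBAL four-term BRIDGE
relation among the dictionary values `(Q, P̂, P)` is a THEOREM at every bridge cluster satisfying the four `RegionHyp`s
(and `dictBridgeBoundary_holds`).  Hence `WedgeDictionaryBridge.cellBridge_of_explicitPQ` needs `explicitPQ` only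
(`cellBridge_of_explicitPQ'`).
What this is NOT: nothing about the integrals themselves (`explicitPQ`, `CellBridge` remain conjecture nodes; the last
corollary is a CONDITIONAL edge), nothing about sizes, denominators or irrationality.
-/

noncomputable section

open Finset

namespace Summit.KontsevichZagierPeriods.Zeta5Search.Elimination

open Summit.KontsevichZagierPeriods.Zeta5Search.WedgeDictionary
open Literature.NumberTheory.Irrationality.BrownZudilin2022 (bOfA Converges QOf convergenceForms)

namespace LevelOne


/-! ### 1. The level-1 case analysis -/

/-- **The three level-1 clusters.**  If `c₀ = b(a)₀ ≤ 1` and the four points `a`, `a − s₇`, `a + e₁ + e₃`, `a + DS`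
satisfy gen-1's `RegionHyp` (in particular the seventeen convergence forms at `a` and at `a − s₇`, the boxes
`0 ≤ 2b_i ≤ b₀ + 1`, `d ≥ 0` and the partner conditions), then `a` is one of three explicit points. -/
theorem level_one_cases (a : Fin 8 → ℤ) {j₀ j₁ j₂ j₃ : ℕ} (hlev : bOfA a 0 ≤ 1) (H₀ : RegionHyp a j₀)
    (H₁ : RegionHyp (a - slotDown 7) j₁) (H₂ : RegionHyp (a + halfUp457) j₂) (H₃ : RegionHyp (a + dsUp) j₃) :
    a = ![1, 0, 1, 0, 1, 1, 1, 1] ∨ a = ![0, 1, 0, 0, 1, 1, 1, 1] ∨ a = ![0, 0, 1, 0, 1, 1, 1, 1] := by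
  obtain ⟨hj₀, hconv₀, hreg₀, hd₀, hpart₀⟩ := H₀
  obtain ⟨-, hconv₁, hreg₁, -, -⟩ := H₁
  obtain ⟨-, -, hreg₂, -, -⟩ := H₂
  obtain ⟨-, -, -, hd₃, -⟩ := H₃
  -- the partner at `a` forces `b₀ ≥ 1`
  have hb0 : 1 ≤ bOfA a 0 := by have := (hreg₀ j₀ hj₀).1; omega
  -- boxes at `a`
  have r1 := hreg₀ 1 (by simp); have r2 := hreg₀ 2 (by simp); have r3 := hreg₀ 3 (by simp)
  have r4 := hreg₀ 4 (by simp); have r5 := hreg₀ 5 (by simp); have r6 := hreg₀ 6 (by simp)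
  have r7 := hreg₀ 7 (by simp)
  -- box of slot 7 at `a − s₇`, of slots 4, 5 at `a + e₁ + e₃`
  have s7 := hreg₁ 7 (by simp)
  rw [bOfA_sub_slotDown7 a 7 (by norm_num), bOfA_sub_slotDown7 a 0 (by norm_num), if_pos rfl,
    if_neg (show (0 : ℕ) ≠ 7 by decide)] at s7
  have t4 := hreg₂ 4 (by simp); have t5 := hreg₂ 5 (by simp)
  rw [bOfA_add_halfUp457 a 4 (by norm_num), bOfA_add_halfUp457 a 0 (by norm_num), if_pos (by decide),
    if_pos (by decide)] at t4
  rw [bOfA_add_halfUp457 a 5 (by norm_num), bOfA_add_halfUp457 a 0 (by norm_num), if_pos (by decide),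
    if_pos (by decide)] at t5
  -- `d ≥ 0` at `a` and at `a + DS`, in the coordinates `a i`
  rw [dOf_bOfA] at hd₀ hd₃
  simp [dsUp] at hd₃
  -- the seventeen convergence forms at `a` and at `a − s₇`
  simp [Converges, convergenceForms] at hconv₀
  simp [Converges, convergenceForms, slotDown] at hconv₁
  simp only [bOfA] at hlev hb0 r1 r2 r3 r4 r5 r6 r7 s7 t4 t5
  -- everything is now linear arithmetic in `a 0, …, a 7`
  have key : (a 0 = 1 ∧ a 1 = 0 ∧ a 2 = 1 ∧ a 3 = 0 ∧ a 4 = 1 ∧ a 5 = 1 ∧ a 6 = 1 ∧ a 7 = 1) ∨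
      (a 0 = 0 ∧ a 1 = 1 ∧ a 2 = 0 ∧ a 3 = 0 ∧ a 4 = 1 ∧ a 5 = 1 ∧ a 6 = 1 ∧ a 7 = 1) ∨
      (a 0 = 0 ∧ a 1 = 0 ∧ a 2 = 1 ∧ a 3 = 0 ∧ a 4 = 1 ∧ a 5 = 1 ∧ a 6 = 1 ∧ a 7 = 1) := by
    omega
  rcases key with ⟨h0, h1, h2, h3, h4, h5, h6, h7⟩ | ⟨h0, h1, h2, h3, h4, h5, h6, h7⟩ | ⟨h0, h1, h2, h3, h4, h5, h6, h7⟩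
  · left; funext i; fin_cases i <;> assumption
  · right; left; funext i; fin_cases i <;> assumption
  · right; right; funext i; fin_cases i <;> assumption

/-! ### 2. The three clusters -/

/-- **gen-1's `DictBridge` at the level-1 cluster of `c = (1; 0,0,0,0,0,0,0)`** (`a = (1,0,1,0,1,1,1,1)`; coefficients `(4, -1, 4, 1)`). -/
theorem cluster_p1 (j₀ j₁ j₂ j₃ : ℕ) (H₀ : RegionHyp ![1, 0, 1, 0, 1, 1, 1, 1] j₀) (H₁ : RegionHyp (![1, 0, 1, 0, 1, 1, 1, 1] - slotDown 7) j₁)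
    (H₂ : RegionHyp (![1, 0, 1, 0, 1, 1, 1, 1] + halfUp457) j₂) (H₃ : RegionHyp (![1, 0, 1, 0, 1, 1, 1, 1] + dsUp) j₃) :
    DictFourTerm (bridgeBase (bOfA ![1, 0, 1, 0, 1, 1, 1, 1])) (bridgeSlot (bOfA ![1, 0, 1, 0, 1, 1, 1, 1])) (bridgeHalf (bOfA ![1, 0, 1, 0, 1, 1, 1, 1]))
      (bridgeApex (bOfA ![1, 0, 1, 0, 1, 1, 1, 1])) ![1, 0, 1, 0, 1, 1, 1, 1] (![1, 0, 1, 0, 1, 1, 1, 1] - slotDown 7) (![1, 0, 1, 0, 1, 1, 1, 1] + halfUp457) (![1, 0, 1, 0, 1, 1, 1, 1] + dsUp) j₀ j₁ j₂ j₃ := by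
  obtain ⟨hQ0, hPh0, hP0⟩ := dict_values H₀
  obtain ⟨hQ1, hPh1, hP1⟩ := dict_values H₁
  obtain ⟨hQ2, hPh2, hP2⟩ := dict_values H₂
  obtain ⟨hQ3, hPh3, hP3⟩ := dict_values H₃
  obtain ⟨cb, cs, ch, ca⟩ := coef_p1
  obtain ⟨r0, r1, r2, r3⟩ := rho_p1
  obtain ⟨x0, y0, z0⟩ := cas_bCorner_one
  obtain ⟨x1, y1, z1⟩ := cas_v1_0000001
  obtain ⟨x2, y2, z2⟩ := cas_v2_0001101
  obtain ⟨x3, y3, z3⟩ := cas_bSym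
  rw [bOfA_p1c, bOfA_p1s, bOfA_p1h, bOfA_p1d] at *
  refine ⟨?_, ?_, ?_⟩
  · rw [cb, cs, ch, ca, hQ0, hQ1, hQ2, hQ3, r0, r1, r2, r3, x0, x1, x2, x3]; norm_num
  · rw [cb, cs, ch, ca, hPh0, hPh1, hPh2, hPh3, r0, r1, r2, r3, y0, y1, y2, y3]; norm_num
  · rw [cb, cs, ch, ca, hP0, hP1, hP2, hP3, r0, r1, r2, r3, z0, z1, z2, z3]; norm_num

/-- **gen-1's `DictBridge` at the level-1 cluster of `c = (1; 0,1,0,0,0,0,0)`** (`a = (0,1,0,0,1,1,1,1)`; coefficients `(2, -1, 4, 1)`). -/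
theorem cluster_p2 (j₀ j₁ j₂ j₃ : ℕ) (H₀ : RegionHyp ![0, 1, 0, 0, 1, 1, 1, 1] j₀) (H₁ : RegionHyp (![0, 1, 0, 0, 1, 1, 1, 1] - slotDown 7) j₁)
    (H₂ : RegionHyp (![0, 1, 0, 0, 1, 1, 1, 1] + halfUp457) j₂) (H₃ : RegionHyp (![0, 1, 0, 0, 1, 1, 1, 1] + dsUp) j₃) :
    DictFourTerm (bridgeBase (bOfA ![0, 1, 0, 0, 1, 1, 1, 1])) (bridgeSlot (bOfA ![0, 1, 0, 0, 1, 1, 1, 1])) (bridgeHalf (bOfA ![0, 1, 0, 0, 1, 1, 1, 1]))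
      (bridgeApex (bOfA ![0, 1, 0, 0, 1, 1, 1, 1])) ![0, 1, 0, 0, 1, 1, 1, 1] (![0, 1, 0, 0, 1, 1, 1, 1] - slotDown 7) (![0, 1, 0, 0, 1, 1, 1, 1] + halfUp457) (![0, 1, 0, 0, 1, 1, 1, 1] + dsUp) j₀ j₁ j₂ j₃ := by
  obtain ⟨hQ0, hPh0, hP0⟩ := dict_values H₀
  obtain ⟨hQ1, hPh1, hP1⟩ := dict_values H₁
  obtain ⟨hQ2, hPh2, hP2⟩ := dict_values H₂
  obtain ⟨hQ3, hPh3, hP3⟩ := dict_values H₃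
  obtain ⟨cb, cs, ch, ca⟩ := coef_p2
  obtain ⟨r0, r1, r2, r3⟩ := rho_p2
  obtain ⟨x0, y0, z0⟩ := cas_v1_0100000
  obtain ⟨x1, y1, z1⟩ := cas_v1_0100001
  obtain ⟨x2, y2, z2⟩ := cas_v2_0101101
  obtain ⟨x3, y3, z3⟩ := cas_v3_1211111
  rw [bOfA_p2c, bOfA_p2s, bOfA_p2h, bOfA_p2d] at *
  refine ⟨?_, ?_, ?_⟩
  · rw [cb, cs, ch, ca, hQ0, hQ1, hQ2, hQ3, r0, r1, r2, r3, x0, x1, x2, x3]; norm_num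
  · rw [cb, cs, ch, ca, hPh0, hPh1, hPh2, hPh3, r0, r1, r2, r3, y0, y1, y2, y3]; norm_num
  · rw [cb, cs, ch, ca, hP0, hP1, hP2, hP3, r0, r1, r2, r3, z0, z1, z2, z3]; norm_num

/-- **gen-1's `DictBridge` at the level-1 cluster of `c = (1; 1,0,0,0,0,0,0)`** (`a = (0,0,1,0,1,1,1,1)`; coefficients `(2, -1, 2, 2)`). -/
theorem cluster_p3 (j₀ j₁ j₂ j₃ : ℕ) (H₀ : RegionHyp ![0, 0, 1, 0, 1, 1, 1, 1] j₀) (H₁ : RegionHyp (![0, 0, 1, 0, 1, 1, 1, 1] - slotDown 7) j₁)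
    (H₂ : RegionHyp (![0, 0, 1, 0, 1, 1, 1, 1] + halfUp457) j₂) (H₃ : RegionHyp (![0, 0, 1, 0, 1, 1, 1, 1] + dsUp) j₃) :
    DictFourTerm (bridgeBase (bOfA ![0, 0, 1, 0, 1, 1, 1, 1])) (bridgeSlot (bOfA ![0, 0, 1, 0, 1, 1, 1, 1])) (bridgeHalf (bOfA ![0, 0, 1, 0, 1, 1, 1, 1]))
      (bridgeApex (bOfA ![0, 0, 1, 0, 1, 1, 1, 1])) ![0, 0, 1, 0, 1, 1, 1, 1] (![0, 0, 1, 0, 1, 1, 1, 1] - slotDown 7) (![0, 0, 1, 0, 1, 1, 1, 1] + halfUp457) (![0, 0, 1, 0, 1, 1, 1, 1] + dsUp) j₀ j₁ j₂ j₃ := by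
  obtain ⟨hQ0, hPh0, hP0⟩ := dict_values H₀
  obtain ⟨hQ1, hPh1, hP1⟩ := dict_values H₁
  obtain ⟨hQ2, hPh2, hP2⟩ := dict_values H₂
  obtain ⟨hQ3, hPh3, hP3⟩ := dict_values H₃
  obtain ⟨cb, cs, ch, ca⟩ := coef_p3
  obtain ⟨r0, r1, r2, r3⟩ := rho_p3
  obtain ⟨x0, y0, z0⟩ := cas_v1_1000000
  obtain ⟨x1, y1, z1⟩ := cas_v1_1000001
  obtain ⟨x2, y2, z2⟩ := cas_v2_1001101
  obtain ⟨x3, y3, z3⟩ := cas_bSym1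
  rw [bOfA_p3c, bOfA_p3s, bOfA_p3h, bOfA_p3d] at *
  refine ⟨?_, ?_, ?_⟩
  · rw [cb, cs, ch, ca, hQ0, hQ1, hQ2, hQ3, r0, r1, r2, r3, x0, x1, x2, x3]; norm_num
  · rw [cb, cs, ch, ca, hPh0, hPh1, hPh2, hPh3, r0, r1, r2, r3, y0, y1, y2, y3]; norm_num
  · rw [cb, cs, ch, ca, hP0, hP1, hP2, hP3, r0, r1, r2, r3, z0, z1, z2, z3]; norm_num

end LevelOne

open LevelOne in
/-- **`DictBridgeLevelOne` holds**: gen-1's four-term `DictBridge` relation at every bridge cluster of level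
`c₀ ≤ 1` — the three clusters `c ∈ {(1;0⁷), (1;0,1,0⁵), (1;1,0⁶)}`, nine rational identities (fam-elim g24's open
leaf of `Elimination/DictBridgeStrata`, discharged). -/
theorem dictBridgeLevelOne_holds : DictBridgeLevelOne := by
  intro a j₀ j₁ j₂ j₃ hlev H₀ H₁ H₂ H₃
  rcases level_one_cases a hlev H₀ H₁ H₂ H₃ with rfl | rfl | rfl
  · exact cluster_p1 j₀ j₁ j₂ j₃ H₀ H₁ H₂ H₃
  · exact cluster_p2 j₀ j₁ j₂ j₃ H₀ H₁ H₂ H₃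
  · exact cluster_p3 j₀ j₁ j₂ j₃ H₀ H₁ H₂ H₃

/-- **The boundary node of `Elimination/DictBridge` holds** (face: fam-elim g24's `dictBridgeFace16_holds`;
level 1: `dictBridgeLevelOne_holds`). -/
theorem dictBridgeBoundary_holds : DictBridgeBoundary := dictBridgeBoundary_of_levelOne dictBridgeLevelOne_holds

/-- **gen-1's GLOBAL `DictBridge` holds**: the four-term BRIDGE relation
`bridgeBase(c)·v(a) + bridgeSlot(c)·v(a − s₇) + bridgeHalf(c)·v(a + e₁ + e₃) + bridgeApex(c)·v(a + DS) = 0` for the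
dictionary vectors `v = (Q, P̂, P)` at EVERY bridge cluster whose four points satisfy `RegionHyp` (interior:
`Elimination/DictBridge.dictBridge_at`; ghost face: `Elimination/DictBridgeFaceLaw`; level 1: this file).  The
`@[conjecture]` node `WedgeDictionary.DictBridge` of `WedgeDictionaryBridge.lean` is thereby discharged. -/
theorem dictBridge_holds : DictBridge := dictBridge_of_levelOne dictBridgeLevelOne_holds

/-- Hence the cellular BRIDGE relations follow from `explicitPQ` alone (CONDITIONAL edge: `explicitPQ` is gen-1's
conjecture node about the integrals; nothing is claimed about it here). -/
theorem cellBridge_of_explicitPQ' (h : explicitPQ) : CellBridge := cellBridge_of_explicitPQ h dictBridge_holds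

end Summit.KontsevichZagierPeriods.Zeta5Search.Elimination
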